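import Mathlib.MeasureTheory.Integral.IntervalIntegral.Basic
import Mathlib.MeasureTheory.Integral.IntervalIntegral.Periodic
import Mathlib.MeasureTheory.Integral.Bochner.Basic
import Mathlib.MeasureTheory.Measure.OpenPos
import Mathlib.MeasureTheory.Measure.Prod
import Mathlib.Analysis.Calculus.ContDiff.Basic
import Mathlib.Analysis.Calculus.Deriv.Pow
import Mathlib.Analysis.Convex.Function
import Mathlib.Analysis.SpecialFunctions.Integrals.Basic
import Literature.Analysis.PDE.BurgersEntropySolutions
import HarnessLib

/-!
# Entropy (Hopf–Oleinik–Kružkov) solutions of the PERIODIC inviscid Burgers equation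

Analysis/FluidPDE definitions file (work item `defn-BurgersEntropySolution`, wanted by route
`BurgersWindow` of `AtomisticToContinuum/HydrodynamicLimit`, items
`stmt-AtomisticToContinuum-5861/5866/5867`): the Cauchy problem for
`∂ₛ w + ∂_ξ (β w²/2) = 0` on `(0,∞) × 𝕋` (`𝕋 = UnitAddCircle`), `w(0,·) = r₀`, `β > 0`, for
`w : ℝ → UnitAddCircle → ℝ` (time, then space; the space variable is lifted to `ℝ` through
`x ↦ (x : UnitAddCircle)` whenever test functions on `ℝ²` are used). This is the periodic, `β`-scaled
companion of `Literature/Analysis/PDE/BurgersEntropySolutions.lean` (line, `β = 1`, `C_c^∞` tests: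
`PDE.IsBurgersWeakSolution`, `PDE.BurgersConditionE` and the named facts
`PDE.hormander_hopfSolution_exists`, `PDE.oleinik_hopfSolution_unique`,
`PDE.deLellisOttoWestdickenberg_singleEntropy`); the dictionary is the LINE LIFT
`burgersLineLift β w (t, x) = β w(t, ↑x)`, under which flux `βw²/2` becomes `u²/2` and the bound
`h/(βs)` becomes `(x₂−x₁)/t`.

* `IsPeriodicBurgersWeakSolution β r₀ u` — bounded, jointly measurable, weak form of the Cauchy
  problem against `C¹` compactly supported tests on `ℝ²`, datum as the `s = 0` layer:
  `∫_{s>0}∫_ℝ (u ψₛ + (β/2) u² ψₓ) + ∫_ℝ r₀ ψ(0,·) = 0` — Hörmander (2.4.1)′ = Dafermos (4.1.6)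
  (Dafermos even allows Lipschitz tests). `.lineLift`: it implies `PDE.IsBurgersWeakSolution` for
  the line lift (PROVED: `C_c^∞ ⊆ C¹_c` and scaling).
* `IsBurgersEntropySolution β r₀ w` — THE REQUESTED NOTION: such a weak solution, weakly continuous
  in time on `(0,∞)`, with OLEINIK'S E-CONDITION `w(s, ξ+h) − w(s, ξ) ≤ h/(βs)` (`s, h > 0`) —
  Hörmander (2.4.8), Dafermos (11.2.1). `isBurgersEntropySolution_iff` unfolds it to the literal
  five-clause conjunction inlined in the route items (same order); `.conditionE_lineLift`: the
  E-condition IS `PDE.BurgersConditionE` of the line lift (PROVED).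
* `SatisfiesBurgersEnergyIneq β r₀ u` (single entropy `η = u²/2`, `q = βu³/3`, initial layer
  included: hypothesis of item 5867), `burgersEntropyFlux β η` (Dafermos (6.2.1)),
  `IsBurgersKruzhkovSolution β r₀ u` (Dafermos Def. 6.2.1 / DLOW Def. 2.1, periodic Cauchy form).
* UNIQUENESS DERIVED, not re-vendored: `IsBurgersEntropySolution.ae_eq` — from the EXISTING fact
  `PDE.oleinik_hopfSolution_unique` (Hörmander Thm 2.4.2 + Thm 2.2.1), two entropy solutions of the
  same periodic problem agree a.e. on `(0,∞) × 𝕋` (line lift + the measure-preserving covering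
  `(t,x) ↦ (t,↑x)` of `ℝ × (0,1]`), hence (`…integral_eq`, weak time-continuity) have equal
  `∫ φ w(s,·)` for EVERY `s > 0` — the uniqueness clause of item 5866.
* ONE residue named fact `burgersPeriodicEntropySolution_exists`: existence of a PERIODIC
  representative with the E-condition pointwise, weak time-continuity and the `C¹`-test identity —
  the part of Dafermos Thm 6.2.1 ((4.1.6) with Lipschitz tests, (6.2.7)) + Thm 11.2.2 and of
  Hörmander Thm 2.4.2 / Lemma 2.4.1 / proof of Thm 2.4.3 that `PDE.hormander_hopfSolution_exists`
  (line, `C_c^∞` tests, no time-regularity, no periodicity of the representative) does not carry.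
* For the single-entropy selection use `PDE.deLellisOttoWestdickenberg_singleEntropy` with
  `Ω = (0,∞) × ℝ`, `u ↦ burgersLineLift β u`, `f = η = v²/2`, `q = v³/3` (then
  `η̃_line(v) = η̃(v/β)` has line flux `burgersEntropyFlux β η̃ (v/β)`); nothing is re-vendored here.

Design: tests are `C¹_c(ℝ²)` as in the route (Dafermos: Lipschitz ⊇ C¹; Hörmander/DLOW: `C_c^∞ ⊆ C¹`);
Kružkov entropies range over ALL convex `η : ℝ → ℝ` (locally Lipschitz, so the interval-integral
flux is the printed `q`); the E-condition is pointwise in `ξ, h` (the Hopf representative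
`(x − y₊(t,x))/t` satisfies it everywhere, Hörmander Lemma 2.4.1). No measurability is imposed on
`r₀` inside the predicates (for non-integrable data the datum integral is Lean's junk `0`); every
fact and bridge quantifies over bounded measurable (or continuous) data. Rest states as entropy
solutions (non-vacuity, sign of the initial layer) are proved in the companion file
`BurgersEntropySolutionProofs.lean`.

## References

* L. Hörmander, *Lectures on Nonlinear Hyperbolic Differential Equations* (1997), Ch. II: Thm 2.2.1,
  (2.4.1)′, Lemma 2.4.1, Thm 2.4.2, (2.4.8), (2.4.10)″, Thm 2.4.3. [Hormander1997]
* C. M. Dafermos, *Hyperbolic Conservation Laws in Continuum Physics*, 2nd ed. (2005), (4.1.6),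
  Def. 6.2.1, (6.2.1)–(6.2.3), (6.2.7), Thms 6.2.1–6.2.2, 11.2.1–11.2.2, §11.4, §11.9. [Dafermos2005]
* E. Hopf, CPAM 3 (1950) 201–230 [Hopf1950]; O. A. Oleĭnik, Uspekhi Mat. Nauk 12 (1957), AMS Transl.
  (2) 26 (1963) 95–172 [Oleinik1963]; S. N. Kružkov, Math. USSR Sb. 10 (1970) 217–243 [Kruzkov1970].
* C. De Lellis, F. Otto, M. Westdickenberg, Quart. Appl. Math. 62 (2004) 687–700 [DelellisOttoWestdickenberg2004];
  E. Yu. Panov, Math. Notes 55 (1994) 517–525 [Panov1994].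
-/

noncomputable section

open Set Function Filter MeasureTheory
open scoped Topology ContDiff

namespace Literature.Analysis.FluidPDE

/-! ### Weak solutions of the periodic Cauchy problem and the line lift -/

/-- **Bounded weak solution of the periodic Cauchy problem for Burgers' equation**
`∂ₛ u + ∂_ξ(β u²/2) = 0`, `u(0,·) = r₀` on the circle: `u` is bounded, jointly measurable, and for
every `C¹` compactly supported test function `ψ` on `ℝ²` (space variable lifted periodically)
`∫_{s>0} ∫_ℝ (u ψₛ + (β/2) u² ψₓ) dx ds + ∫_ℝ r₀ ψ(0,·) dx = 0` — the distributional Cauchy problem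
with source `r₀ ⊗ δ(s)`: Hörmander's (2.4.1)′ (`β = 1`, `C_c^∞` tests) and Dafermos's (4.1.6)
(Lipschitz tests). No measurability of `r₀` is built in (junk value `0` of the datum integral for
non-integrable data). The periodic, `β`-scaled, `C¹`-test form of `PDE.IsBurgersWeakSolution`
(see `.lineLift`). [cite: Dafermos2005, §4.1 (4.1.6)] -/
structure IsPeriodicBurgersWeakSolution (β : ℝ) (r₀ : UnitAddCircle → ℝ)
    (u : ℝ → UnitAddCircle → ℝ) : Prop where
  /-- `u` is bounded on `ℝ × 𝕋`. -/
  bounded : ∃ M : ℝ, ∀ s ξ, |u s ξ| ≤ M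
  /-- `u` is jointly (Borel) measurable. -/
  measurable : Measurable (Function.uncurry u)
  /-- the weak form of the Cauchy problem, datum included (Hörmander (2.4.1)′, Dafermos (4.1.6)). -/
  weakForm : ∀ ψ : ℝ × ℝ → ℝ, ContDiff ℝ 1 ψ → HasCompactSupport ψ →
    (∫ s in Set.Ioi (0 : ℝ), ∫ x : ℝ,
        (u s (x : UnitAddCircle) * deriv (fun s' => ψ (s', x)) s
          + β / 2 * u s (x : UnitAddCircle) ^ 2 * deriv (fun x' => ψ (s, x')) x))
      + ∫ x : ℝ, r₀ (x : UnitAddCircle) * ψ (0, x) = 0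

/-- **The line lift** `U(t, x) = β · w(t, ↑x)` of a periodic field: `w` solves the `βw²/2`-flux
equation on the circle iff `U` solves Burgers' equation `Uₜ + (U²/2)ₓ = 0` on the line (the
dictionary to `Literature/Analysis/PDE/BurgersEntropySolutions.lean`). [folklore] -/
def burgersLineLift (β : ℝ) (w : ℝ → UnitAddCircle → ℝ) : ℝ → ℝ → ℝ :=
  fun t x => β * w t (x : UnitAddCircle)

/-- Unfolding the line lift. [folklore] -/
@[simp] theorem burgersLineLift_apply (β : ℝ) (w : ℝ → UnitAddCircle → ℝ) (t x : ℝ) :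
    burgersLineLift β w t x = β * w t (x : UnitAddCircle) := rfl

/-- The line lift of a jointly measurable periodic field is jointly measurable. [folklore] -/
theorem measurable_uncurry_burgersLineLift (β : ℝ) {w : ℝ → UnitAddCircle → ℝ}
    (hw : Measurable (Function.uncurry w)) :
    Measurable (Function.uncurry (burgersLineLift β w)) := by
  change Measurable fun p : ℝ × ℝ => β * w p.1 (p.2 : UnitAddCircle)
  exact (hw.comp (measurable_fst.prodMk (AddCircle.measurable_mk'.comp measurable_snd))).const_mul β

/-- **Periodic weak solutions lift to weak solutions on the line** (Hörmander (2.4.1)′ for the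
datum `β r₀ ∘ (↑)`): `C_c^∞` tests are `C¹`, and the identity scales by `β`. [folklore] -/
theorem IsPeriodicBurgersWeakSolution.lineLift {β : ℝ} {r₀ : UnitAddCircle → ℝ}
    {u : ℝ → UnitAddCircle → ℝ} (hu : IsPeriodicBurgersWeakSolution β r₀ u) :
    PDE.IsBurgersWeakSolution (fun x => β * r₀ (x : UnitAddCircle)) (burgersLineLift β u) := by
  intro φ hφ hsupp
  have key := hu.weakForm φ (hφ.of_le (mod_cast le_top)) hsupp
  have h1 : ∫ t in Set.Ioi (0 : ℝ), ∫ x : ℝ, (burgersLineLift β u t x * deriv (fun t' => φ (t', x)) t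
      + 1 / 2 * burgersLineLift β u t x ^ 2 * deriv (fun x' => φ (t, x')) x)
      = β * ∫ s in Set.Ioi (0 : ℝ), ∫ x : ℝ, (u s (x : UnitAddCircle) * deriv (fun s' => φ (s', x)) s
        + β / 2 * u s (x : UnitAddCircle) ^ 2 * deriv (fun x' => φ (s, x')) x) := by
    rw [← MeasureTheory.integral_const_mul]
    refine integral_congr_ae (Filter.Eventually.of_forall fun s => ?_)
    show _ = β * _
    rw [← MeasureTheory.integral_const_mul]
    refine integral_congr_ae (Filter.Eventually.of_forall fun x => ?_)
    show _ = β * _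
    simp only [burgersLineLift_apply]
    ring
  have h2 : ∫ x : ℝ, β * r₀ (x : UnitAddCircle) * φ (0, x) = β * ∫ x : ℝ, r₀ (x : UnitAddCircle) * φ (0, x) := by
    rw [← MeasureTheory.integral_const_mul]
    refine integral_congr_ae (Filter.Eventually.of_forall fun x => ?_)
    show _ = β * _
    ring
  rw [h1, h2]
  linear_combination (-β) * key

/-! ### The requested notion: Oleinik (Hopf–Lax–Oleinik) entropy solutions -/

/-- **Entropy solution of the periodic Burgers equation in Oleinik's sense.** For `β > 0` and a
bounded datum `r₀` on the circle, `w : ℝ → 𝕋 → ℝ` is an entropy solution of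
`∂ₛ w + ∂_ξ(β w²/2) = 0`, `w(0,·) = r₀`, if it is a bounded measurable weak solution of the Cauchy
problem (`IsPeriodicBurgersWeakSolution`), is weakly continuous in time on `(0,∞)`
(`s ↦ ∫ φ w(s,·)` continuous for continuous `φ`), and satisfies OLEINIK'S E-CONDITION in the
one-sided Lipschitz form `w(s, ξ + h) − w(s, ξ) ≤ h/(β s)` for all `s > 0`, `ξ`, `h > 0`
(Hörmander (2.4.8): `u(t,x₂+0) − u(t,x₁−0) ≤ (x₂−x₁)/t` for `β = 1`; Dafermos (11.2.1) with
`f′(u) = βu`). By Hopf 1950 / Oleinik 1957 such a `w` exists (`burgersPeriodicEntropySolution_exists`)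
and the E-condition characterises it among bounded weak solutions (`IsBurgersEntropySolution.ae_eq`,
from `PDE.oleinik_hopfSolution_unique`). [cite: Hormander1997, Thm 2.4.2 and (2.4.8)] -/
structure IsBurgersEntropySolution (β : ℝ) (r₀ : UnitAddCircle → ℝ) (w : ℝ → UnitAddCircle → ℝ) :
    Prop extends IsPeriodicBurgersWeakSolution β r₀ w where
  /-- weak continuity in time on `(0, ∞)` against continuous functions on the circle. -/
  weaklyContinuousOn : ∀ φ : UnitAddCircle → ℝ, Continuous φ →
    ContinuousOn (fun s => ∫ ξ, φ ξ * w s ξ) (Set.Ioi 0)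
  /-- Oleinik's E-condition `w(s, ξ+h) − w(s, ξ) ≤ h/(βs)` (one-sided Lipschitz bound). -/
  oleinik : ∀ s : ℝ, 0 < s → ∀ ξ : UnitAddCircle, ∀ h : ℝ, 0 < h →
    w s (ξ + (h : UnitAddCircle)) - w s ξ ≤ h / (β * s)

/-- `IsBurgersEntropySolution` unfolded to the literal five-clause conjunction (bounded, measurable,
weakly continuous, Oleinik, weak form) inlined in the `BurgersWindow` route items. [folklore] -/
theorem isBurgersEntropySolution_iff {β : ℝ} {r₀ : UnitAddCircle → ℝ}
    {w : ℝ → UnitAddCircle → ℝ} :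
    IsBurgersEntropySolution β r₀ w ↔
      (∃ M : ℝ, ∀ s ξ, |w s ξ| ≤ M) ∧ Measurable (Function.uncurry w) ∧
      (∀ φ : UnitAddCircle → ℝ, Continuous φ →
        ContinuousOn (fun s => ∫ ξ, φ ξ * w s ξ) (Set.Ioi 0)) ∧
      (∀ s : ℝ, 0 < s → ∀ ξ : UnitAddCircle, ∀ h : ℝ, 0 < h →
        w s (ξ + (h : UnitAddCircle)) - w s ξ ≤ h / (β * s)) ∧
      (∀ ψ : ℝ × ℝ → ℝ, ContDiff ℝ 1 ψ → HasCompactSupport ψ →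
        (∫ s in Set.Ioi (0 : ℝ), ∫ x : ℝ,
            (w s (x : UnitAddCircle) * deriv (fun s' => ψ (s', x)) s
              + β / 2 * w s (x : UnitAddCircle) ^ 2 * deriv (fun x' => ψ (s, x')) x))
          + ∫ x : ℝ, r₀ (x : UnitAddCircle) * ψ (0, x) = 0) :=
  ⟨fun h => ⟨h.bounded, h.measurable, h.weaklyContinuousOn, h.oleinik, h.weakForm⟩,
    fun h => ⟨⟨h.1, h.2.1, h.2.2.2.2⟩, h.2.2.1, h.2.2.2.1⟩⟩

/-- From a.e. coincidence on `(0,∞) × 𝕋` to coincidence of ALL spatial averages at EVERY positive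
time: if two entropy solutions (indeed any two fields weakly continuous in time on `(0,∞)`) agree
a.e. on `{s > 0}`, then `∫ φ w(s,·) = ∫ φ w′(s,·)` for every `s > 0` and continuous `φ` (Fubini for
null sets, then continuity on the open half-line). This turns the printed a.e.-uniqueness
(`IsBurgersEntropySolution.ae_eq`) into the uniqueness clause of item 5866. [folklore] -/
theorem IsBurgersEntropySolution.integral_eq_of_ae_eq {β : ℝ} {r₀ : UnitAddCircle → ℝ}
    {w w' : ℝ → UnitAddCircle → ℝ} (hw : IsBurgersEntropySolution β r₀ w)
    (hw' : IsBurgersEntropySolution β r₀ w')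
    (hae : ∀ᵐ p : ℝ × UnitAddCircle, 0 < p.1 → w p.1 p.2 = w' p.1 p.2)
    {s : ℝ} (hs : 0 < s) {φ : UnitAddCircle → ℝ} (hφ : Continuous φ) :
    ∫ ξ, φ ξ * w s ξ = ∫ ξ, φ ξ * w' s ξ := by
  have h2 : ∀ᵐ t : ℝ, t ∈ Set.Ioi (0 : ℝ) →
      (fun t => ∫ ξ, φ ξ * w t ξ) t = (fun t => ∫ ξ, φ ξ * w' t ξ) t := by
    filter_upwards [Measure.ae_ae_of_ae_prod (μ := volume) (ν := volume) hae] with t ht ht0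
    refine integral_congr_ae ?_
    filter_upwards [ht] with ξ hξ
    rw [hξ ht0]
  exact Measure.eqOn_open_of_ae_eq ((ae_restrict_iff' measurableSet_Ioi).2 h2) isOpen_Ioi
    (hw.weaklyContinuousOn φ hφ) (hw'.weaklyContinuousOn φ hφ) hs

/-! ### Entropy inequalities: the energy `η = u²/2` and Kružkov's family -/

/-- **The single (energy) entropy inequality** for the periodic Burgers Cauchy problem, entropy
`η(u) = u²/2` (uniformly convex), flux `q(u) = β u³/3`, INITIAL LAYER INCLUDED:
`∫_{s>0}∫_ℝ (u²/2 ψₛ + (β/3) u³ ψₓ) + ∫_ℝ r₀²/2 ψ(0,·) ≥ 0` for all nonnegative `C¹` compactly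
supported `ψ` on `ℝ²` — Dafermos's (6.2.3) for this one `η` (the hypothesis of item 5867; by
De Lellis–Otto–Westdickenberg / Panov this single inequality already selects the entropy solution:
`PDE.deLellisOttoWestdickenberg_singleEntropy`). [cite: Dafermos2005, Def. 6.2.1 (6.2.3)] -/
def SatisfiesBurgersEnergyIneq (β : ℝ) (r₀ : UnitAddCircle → ℝ) (u : ℝ → UnitAddCircle → ℝ) :
    Prop :=
  ∀ ψ : ℝ × ℝ → ℝ, ContDiff ℝ 1 ψ → HasCompactSupport ψ → (∀ p, 0 ≤ ψ p) →
    0 ≤ (∫ s in Set.Ioi (0 : ℝ), ∫ x : ℝ,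
        (u s (x : UnitAddCircle) ^ 2 / 2 * deriv (fun s' => ψ (s', x)) s
          + β / 3 * u s (x : UnitAddCircle) ^ 3 * deriv (fun x' => ψ (s, x')) x))
      + ∫ x : ℝ, r₀ (x : UnitAddCircle) ^ 2 / 2 * ψ (0, x)

/-- **Entropy flux** of the entropy `η` for the Burgers flux `f(u) = βu²/2`:
`q(u) = ∫₀ᵘ η′(v) f′(v) dv = ∫₀ᵘ η′(v) β v dv` (Dafermos (6.2.1), normalised by `q(0) = 0`; for a
convex `η` the derivative exists off a countable set and is locally bounded, so this is the printed
locally Lipschitz flux with `q′ = f′η′` a.e.). [cite: Dafermos2005, §6.2 (6.2.1)] -/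
def burgersEntropyFlux (β : ℝ) (η : ℝ → ℝ) (u : ℝ) : ℝ :=
  ∫ v in (0 : ℝ)..u, deriv η v * (β * v)

/-- The flux of the energy `η(u) = u²/2` is `q(u) = β u³/3`. [folklore] -/
theorem burgersEntropyFlux_sq_half (β u : ℝ) :
    burgersEntropyFlux β (fun v => v ^ 2 / 2) u = β / 3 * u ^ 3 := by
  have hd : deriv (fun v : ℝ => v ^ 2 / 2) = fun v => v := by
    funext v; rw [deriv_div_const, deriv_pow_field]; ring
  simp only [burgersEntropyFlux, hd]
  have : (fun v : ℝ => v * (β * v)) = fun v => β * v ^ 2 := by funext v; ring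
  rw [this, intervalIntegral.integral_const_mul, integral_pow]
  ring

/-- The flux of the identity entropy `η(u) = u` is the Burgers flux `β u²/2` itself. [folklore] -/
theorem burgersEntropyFlux_id (β u : ℝ) :
    burgersEntropyFlux β (fun v => v) u = β / 2 * u ^ 2 := by
  simp only [burgersEntropyFlux, deriv_id'', one_mul]
  rw [intervalIntegral.integral_const_mul, integral_id]
  ring

/-- **Kružkov entropy (admissible weak) solution of the periodic Burgers Cauchy problem**
(Dafermos Def. 6.2.1, specialised to `m = 1`, `g(u) = βu²/2`, periodic data, `C¹` tests;
De Lellis–Otto–Westdickenberg Def. 2.1 plus the initial layer): a bounded measurable weak solution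
`u` such that for EVERY convex `η : ℝ → ℝ`, with flux `q = burgersEntropyFlux β η`, and every
nonnegative `C¹` compactly supported `ψ` on `ℝ²`,
`∫_{s>0}∫_ℝ (η(u) ψₛ + q(u) ψₓ) dx ds + ∫_ℝ η(r₀) ψ(0,·) dx ≥ 0` (Dafermos (6.2.3)). Kružkov 1970
proved existence and uniqueness in this class for `L^∞` data (Dafermos Thm 6.2.1).
[cite: Dafermos2005, Def. 6.2.1] -/
structure IsBurgersKruzhkovSolution (β : ℝ) (r₀ : UnitAddCircle → ℝ)
    (u : ℝ → UnitAddCircle → ℝ) : Prop extends IsPeriodicBurgersWeakSolution β r₀ u where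
  /-- all convex entropy inequalities, initial layer included (Dafermos (6.2.3)). -/
  entropyIneq : ∀ η : ℝ → ℝ, ConvexOn ℝ Set.univ η →
    ∀ ψ : ℝ × ℝ → ℝ, ContDiff ℝ 1 ψ → HasCompactSupport ψ → (∀ p, 0 ≤ ψ p) →
      0 ≤ (∫ s in Set.Ioi (0 : ℝ), ∫ x : ℝ,
          (η (u s (x : UnitAddCircle)) * deriv (fun s' => ψ (s', x)) s
            + burgersEntropyFlux β η (u s (x : UnitAddCircle)) * deriv (fun x' => ψ (s, x')) x))
        + ∫ x : ℝ, η (r₀ (x : UnitAddCircle)) * ψ (0, x)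

/-- A Kružkov entropy solution satisfies in particular the single energy inequality
(`η = u²/2`, `q = βu³/3`). [folklore] -/
theorem IsBurgersKruzhkovSolution.energyIneq {β : ℝ} {r₀ : UnitAddCircle → ℝ}
    {u : ℝ → UnitAddCircle → ℝ} (hu : IsBurgersKruzhkovSolution β r₀ u) :
    SatisfiesBurgersEnergyIneq β r₀ u := by
  intro ψ hψ hsupp hpos
  have hconv : ConvexOn ℝ Set.univ (fun v : ℝ => v ^ 2 / 2) := by
    have h := (Even.convexOn_pow (𝕜 := ℝ) (by decide : Even 2))
    simpa [div_eq_mul_inv, mul_comm] using h.smul (show (0 : ℝ) ≤ 1 / 2 by norm_num)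
  have h := hu.entropyIneq (fun v => v ^ 2 / 2) hconv ψ hψ hsupp hpos
  simpa only [burgersEntropyFlux_sq_half] using h

/-- **Oleinik's E-condition of a periodic entropy solution is `PDE.BurgersConditionE` of its line
lift**: `βw(t,↑x₂) − βw(t,↑x₁) ≤ (x₂ − x₁)/t` (Hörmander (2.4.8)). [folklore] -/
theorem IsBurgersEntropySolution.conditionE_lineLift {β : ℝ} (hβ : 0 < β) {r₀ : UnitAddCircle → ℝ}
    {w : ℝ → UnitAddCircle → ℝ} (hw : IsBurgersEntropySolution β r₀ w) :
    PDE.BurgersConditionE (burgersLineLift β w) := by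
  intro t ht x₁ x₂ hle
  simp only [burgersLineLift_apply]
  rcases hle.eq_or_lt with h | hlt
  · subst h
    simp
  · have h := hw.oleinik t ht (x₁ : UnitAddCircle) (x₂ - x₁) (sub_pos.mpr hlt)
    have hx : (x₁ : UnitAddCircle) + ((x₂ - x₁ : ℝ) : UnitAddCircle) = (x₂ : UnitAddCircle) := by
      rw [← AddCircle.coe_add]
      congr 1
      ring
    rw [hx] at h
    calc β * w t x₂ - β * w t x₁ = β * (w t x₂ - w t x₁) := by ring
      _ ≤ β * ((x₂ - x₁) / (β * t)) := mul_le_mul_of_nonneg_left h hβ.le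
      _ = (x₂ - x₁) / t := by field_simp

/-- **A.e. uniqueness of periodic entropy solutions, DERIVED from Oleinik's theorem on the line**
(`PDE.oleinik_hopfSolution_unique` = Hörmander Thm 2.4.2 + Thm 2.2.1): the line lifts of two
entropy solutions of the same periodic problem are bounded measurable weak solutions of (2.4.1)′
with the same datum and condition E, hence agree a.e. on `{t > 0} ⊆ ℝ²`; the covering map
`(t,x) ↦ (t,↑x)` is measure-preserving from `ℝ × (0,1]` onto `ℝ × 𝕋`, so they agree a.e. on
`(0,∞) × 𝕋`. [folklore] -/
theorem IsBurgersEntropySolution.ae_eq (h : PDE.oleinik_hopfSolution_unique) {β : ℝ} (hβ : 0 < β)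
    {r₀ : UnitAddCircle → ℝ} {w w' : ℝ → UnitAddCircle → ℝ}
    (hw : IsBurgersEntropySolution β r₀ w) (hw' : IsBurgersEntropySolution β r₀ w') :
    ∀ᵐ p : ℝ × UnitAddCircle, 0 < p.1 → w p.1 p.2 = w' p.1 p.2 := by
  obtain ⟨M, hM⟩ := hw.bounded
  obtain ⟨M', hM'⟩ := hw'.bounded
  -- Oleinik's theorem for the line lifts
  have hline : ∀ᵐ p : ℝ × ℝ, 0 < p.1 → burgersLineLift β w p.1 p.2 = burgersLineLift β w' p.1 p.2 :=
    h _ _ _ (|β| * max M M') (measurable_uncurry_burgersLineLift β hw.measurable)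
      (measurable_uncurry_burgersLineLift β hw'.measurable)
      (fun t x _ => by
        rw [burgersLineLift_apply, abs_mul]
        exact mul_le_mul_of_nonneg_left ((hM t _).trans (le_max_left _ _)) (abs_nonneg β))
      (fun t x _ => by
        rw [burgersLineLift_apply, abs_mul]
        exact mul_le_mul_of_nonneg_left ((hM' t _).trans (le_max_right _ _)) (abs_nonneg β))
      hw.lineLift hw'.lineLift (hw.conditionE_lineLift hβ) (hw'.conditionE_lineLift hβ)
  -- the exceptional set on the line is null
  have hN : volume {p : ℝ × ℝ | ¬(0 < p.1 → w p.1 (p.2 : UnitAddCircle) = w' p.1 (p.2 : UnitAddCircle))}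
      = 0 := by
    rw [← ae_iff]
    filter_upwards [hline] with p hp hp0
    exact mul_left_cancel₀ hβ.ne' (by simpa only [burgersLineLift_apply] using hp hp0)
  -- transfer through the measure-preserving covering `(t, x) ↦ (t, ↑x)` of `ℝ × (0, 1]`
  set S : Set (ℝ × UnitAddCircle) := {q | ¬(0 < q.1 → w q.1 q.2 = w' q.1 q.2)} with hS
  have hSm : MeasurableSet S := by
    have : S = {q : ℝ × UnitAddCircle | 0 < q.1} \ {q | Function.uncurry w q = Function.uncurry w' q} := by
      ext q
      simp only [hS, Set.mem_setOf_eq, Set.mem_sdiff, Function.uncurry, Classical.not_imp]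
    rw [this]
    exact (measurableSet_lt measurable_const measurable_fst).diff
      (measurableSet_eq_fun hw.measurable hw'.measurable)
  have hpres : MeasurePreserving (Prod.map id ((↑) : ℝ → UnitAddCircle))
      ((volume : Measure ℝ).prod (volume.restrict (Set.Ioc (0 : ℝ) (0 + 1))))
      ((volume : Measure ℝ).prod volume) :=
    (MeasurePreserving.id volume).prod (UnitAddCircle.measurePreserving_mk 0)
  have h0 : ((volume : Measure ℝ).prod (volume.restrict (Set.Ioc (0 : ℝ) (0 + 1))))
      (Prod.map id ((↑) : ℝ → UnitAddCircle) ⁻¹' S) = 0 := by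
    refine le_antisymm ?_ bot_le
    have hrw : (volume : Measure ℝ).prod (volume.restrict (Set.Ioc (0 : ℝ) (0 + 1)))
        = ((volume : Measure ℝ).prod volume).restrict (Set.univ ×ˢ Set.Ioc (0 : ℝ) (0 + 1)) := by
      rw [← Measure.prod_restrict, Measure.restrict_univ]
    rw [hrw]
    exact (Measure.restrict_apply_le _ _).trans hN.le
  have hvol : (volume : Measure (ℝ × UnitAddCircle)) S = 0 := by
    rw [Measure.volume_eq_prod, ← hpres.measure_preimage hSm.nullMeasurableSet, h0]
  exact ae_iff.mpr hvol

/-- Uniqueness in the form of item 5866, from Oleinik's theorem on the line: two entropy solutions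
of the same periodic problem have the same spatial averages at EVERY positive time. [folklore] -/
theorem IsBurgersEntropySolution.integral_eq (h : PDE.oleinik_hopfSolution_unique) {β : ℝ}
    (hβ : 0 < β) {r₀ : UnitAddCircle → ℝ} {w w' : ℝ → UnitAddCircle → ℝ}
    (hw : IsBurgersEntropySolution β r₀ w) (hw' : IsBurgersEntropySolution β r₀ w')
    {s : ℝ} (hs : 0 < s) {φ : UnitAddCircle → ℝ} (hφ : Continuous φ) :
    ∫ ξ, φ ξ * w s ξ = ∫ ξ, φ ξ * w' s ξ :=
  hw.integral_eq_of_ae_eq hw' (hw.ae_eq h hβ hw') hs hφ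

/-! ### The residue named fact: a periodic representative, weakly continuous in time -/

/-- **Existence of the periodic entropy solution with a good representative (Dafermos 2005,
Thm 6.2.1 with (4.1.6), (6.2.7), and Thm 11.2.2; Hörmander 1997, Thm 2.4.2, Lemma 2.4.1 and proof
of Thm 2.4.3; Hopf 1950).** For `β > 0` and a bounded measurable datum `r₀` on the circle there is
`w` with `IsBurgersEntropySolution β r₀ w`. RESIDUE FACT: the line statement Hörmander Thm 2.4.2
(`C_c^∞` tests, no time-regularity) is `PDE.hormander_hopfSolution_exists`; NOT derivable from it,
and recorded here, are (a) an `x`-PERIODIC representative satisfying the E-condition pointwise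
(uniqueness makes the solution periodic only a.e.; the right-continuous `BV` representative of
Dafermos Thm 11.2.2 is periodic and satisfies (11.2.1) `(f′(u(y±,t)) − f′(u(x±,t)))/(y−x) ≤ 1/t`
everywhere; for Burgers `y₊(t,·)` is nondecreasing, Hörmander Lemma 2.4.1), (b) weak continuity
in `t` on `(0,∞)` (Dafermos (6.2.7): `u ∈ C⁰([0,∞); L¹_loc)`; Hörmander, proof of Thm 2.4.3), and
(c) the identity for `C¹` tests (Dafermos (4.1.6) is stated for all LIPSCHITZ compactly supported
tests, and (6.2.3) ⇒ (4.1.6)). The flux `βu²/2` and the bound `h/(βs)` are the scaling `u = βw`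
of the printed `β = 1` statements; periodic data are bounded data on `ℝ`.
[cite: Dafermos2005, Thm 6.2.1 with (4.1.6), (6.2.7) and Thm 11.2.2]
[cite: Hormander1997, Thm 2.4.2, Lemma 2.4.1, proof of Thm 2.4.3] -/
def burgersPeriodicEntropySolution_exists : Prop :=
  ∀ β : ℝ, 0 < β → ∀ r₀ : UnitAddCircle → ℝ, (∃ M : ℝ, ∀ ξ, |r₀ ξ| ≤ M) → Measurable r₀ →
    ∃ w : ℝ → UnitAddCircle → ℝ, IsBurgersEntropySolution β r₀ w

/-- Existence for CONTINUOUS data (the form of item 5866): a continuous function on the compact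
circle is bounded and Borel measurable. [folklore] -/
theorem IsBurgersEntropySolution.exists_of_continuous (h : burgersPeriodicEntropySolution_exists)
    {β : ℝ} (hβ : 0 < β) {r₀ : UnitAddCircle → ℝ} (hr : Continuous r₀) :
    ∃ w : ℝ → UnitAddCircle → ℝ, IsBurgersEntropySolution β r₀ w := by
  obtain ⟨M, hM⟩ := (isCompact_univ.image hr).isBounded.subset_closedBall (0 : ℝ)
  refine h β hβ r₀ ⟨M, fun ξ => ?_⟩ hr.measurable
  have := hM ⟨ξ, Set.mem_univ _, rfl⟩
  simpa [Real.norm_eq_abs] using this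

end Literature.Analysis.FluidPDE
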